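import Summits.BirchSwinnertonDyer.Rank1Residual.WAll.TargetCMTwoRamifiedSMinus
import HarnessLib
import HarnessLib.Audit.Tags

/-!
# Rung W-ALL of ladder BSD (D-0120) — the ramified slice of row 12₂: THE TYZ GENUS CLASS AT `ρ = 0` IN
# RESIDUE CLASS `6 (mod 8)` CARVED OUT OF THE RESIDUAL OF THE p1 ROAD, BY NAME (cell `bsd-print-cf2`, D-0131 (2)
# PRINT TIER, seat p1; crux stmt-BirchSwinnertonDyer-20509 `RamifiedOffTYZOfFacts` of route `PrintCf2`)

HONEST FRAMING (cell `bsd-print-cf2`, run/shared/lean/pub/bsd-print-cf2/; partition leaf «CornerF @ `p = 2`» =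
`Summit.BirchSwinnertonDyer.WAllCornerFTwo`, OPEN AS A CLASS): STATEMENTS AND BOOKKEEPING ONLY — nothing asserted,
nothing booked, no named fact introduced, no published theorem restated. The flag-free TYZ family predicate
`CongruentTYZProvedFamily` (`WAll/TargetCMTwoRamifiedFamilies.lean`, p533515) carries the Tian–Yuan–Zhang genus class
at `ρ(n) = 0` ONLY for `n ≡ 5, 7 (mod 8)` (its fifth disjunct TYZρ); the `n ≡ 6 (mod 8)` members of the same shape —
square-free `n ≡ 6 (8)`, `#Sel₂(E_n) = 8`, `ρ(n) = 0` (`[E_n(ℚ) : φ_n(A_n(ℚ)) + E_n[2]] = 1`), second genus sum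
`Σ₂′(n)` odd — were left to the U⁺ road (`CongruentTYZUPlusFamily`, second disjunct, `n ≡ 6` clause: closed only
modulo the ∃-display `tyz_genusPointData`, LITERAL, aside 20471). But Tian–Yuan–Zhang Thm 1.2 AS PRINTED has an
`n ≡ 6 (mod 8)` clause (`2^{ρ+1} ∣ 𝓛(n) ⇒ Σ₂′(n)` even), typed in `thm12_parity_of_scriptL'` and drawn in the tree as
`TianYuanZhang2017.rankOneDatum_of_index_eq_one_six'`; so this class closes EXACTLY like TYZρ — modulo TYZ Thm 1.2 as
printed (`h12`, conjunct 5 of `𝔅_ram`) and Gross–Zagier–Kolyvagin (`hGZK`, conjunct 1) — FLAG-FREE inside the route's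
bundle (closer `PrintCf2.wAllCornerFTwoRamifiedTYZRhoSix_of_facts`, Theorems file
`PrintCf2RamifiedOffTYZRhoSixLeaf.lean`). This file names the class and the slice: membership predicate
`CongruentTYZRhoSixFamily` (§1), leaf `WAllCornerFTwoRamifiedTYZRhoSix` and the two residuals with `𝒮⁻` AND the
ρ-six class carved out — `WAllCornerFTwoRamifiedOffTYZProvedOffSMinusOffRhoSix` (flag-free road) and
`WAllCornerFTwoRamifiedOffTYZOffSMinusOffRhoSix` (six-way) (§2) — membership facts incl. disjointness from the proved
TYZ families (even vs. odd parameter, §3), and the glue (§4; excluded middle on membership, exact thanks to §3):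
`wAllCornerFTwoRamifiedOffTYZProved_iff_sMinus_rhoSix_off` (crux 20509's conclusion ⟺ 𝒮⁻ leaf ∧ ρ-six leaf ∧
residual), `wAllCornerFTwoRamified_iff_tyzProved_sMinus_rhoSix_off`, the five-leaf composition
`wAllCornerFTwoRamifiedOffTYZProved_of_uPlus_of_atlasFJ_of_sMinus_of_rhoSix_of_off` used by the reshaped skeleton of
crux 20509, and the reduction of the five-way residual to the ρ-six leaf ∧ the six-way residual.

WHY (seat p1, strategy «Tian–Yuan–Zhang induction BY NAME … typed as class theorems on explicit infinite families»):
the ρ-six class is the `n ≡ 6 (mod 8)` third of the per-`n` content of Tian's ICM 2022 Thm 8 / Thm 13 with its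
unprinted step `ρ(n) = 0` kept as a hypothesis; as an ASSEMBLY of printed inputs it is beyond print (no printed
theorem states BSD(E_n, 2) for these `n`; Tian ICM22 p. 1993 attributes the `2`-part to [50, 51] without a statement
covering `n ≡ 6`).

References: `WAll/TargetCMTwoRamifiedFamilies.lean` (p533515), `WAll/TargetCMTwoRamifiedOffTYZProved.lean` (p536500),
`WAll/TargetCMTwoRamifiedSMinus.lean` (p544597), `WAll/AltClosersCMTwoRamifiedFamilies.lean` (p535702: the TYZρ closer
`rankOne_sha_bsdp_two_congruentNumberCurve_of_tyzGenus`, classes 5/7), `Literature/…/TianYuanZhang2017/ScriptLOddOfRhoZero.lean`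
(`rankOneDatum_of_index_eq_one_six'`). [cite: TianYuanZhang2017, Thm. 1.2 (n ≡ 6 clause) and §1 (ρ(n), (1.1))]
[cite: Tian2023CongruentICM, Thm. 8 (p. 1996), Thm. 13 (p. 2000–2001)] [cite: Miller2011LMS, §1 and Def. 1.1].
-/

noncomputable section

open scoped Classical

open WeierstrassCurve Literature.NumberTheory.EllipticCurves
  Literature.NumberTheory.EllipticCurves.Rank1Residual
  Literature.NumberTheory.EllipticCurves.TianYuanZhang2017
open Summit.BirchSwinnertonDyer.Rank1Residual

set_option autoImplicit false

namespace Summit.BirchSwinnertonDyer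

/-! ### §1. Membership predicate: the TYZ genus class at `ρ = 0`, residue class `6 (mod 8)` -/

/-- **The TYZ genus class at `ρ = 0` in residue class `6 (mod 8)`** as a class at `2`: `W` is a `ℚ`-model of `E_n`
with `n` square-free, `n ≡ 6 (mod 8)`, `#Sel₂(E_n) = 8` (`s(n) = 1`), `[E_n(ℚ) : φ_n(A_n(ℚ)) + E_n[2]] = 1`
(`ρ(n) = 0`, tree `rhoSubgroup`) and the second genus sum `Σ₂′(n)` (tree `genusSum₂'`, over `K_d = GenusField d`)
ODD — the `n ≡ 6` companion of the TYZρ disjunct of `CongruentTYZProvedFamily`. A predicate; nothing asserted.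
[cite: TianYuanZhang2017, Thm. 1.2 and §1 (ρ(n), g(d))] [cite: Tian2023CongruentICM, Thm. 8 and Thm. 13] -/
def CongruentTYZRhoSixFamily : P2.ClassAtTwo := fun W _ _ =>
  ∃ (n : ℕ) (hsq : Squarefree n), n % 8 = 6 ∧
    (haveI := isElliptic_congruentNumberCurve hsq.ne_zero;
      Nat.card ((congruentNumberCurve n).selmerGroup 2) = 8) ∧
    (rhoSubgroup n).index = 1 ∧
    Odd (genusSum₂' n fun d => genusClassNumber (GenusField d)) ∧
    ∃ C : VariableChange ℚ, C • congruentNumberCurve n = W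

/-! ### §2. Leaves: the ρ-six slice and the residuals off it -/

/-- **Ramified slice ON THE ρ-SIX GENUS CLASS** (closed INSIDE `𝔅_ram` by
`PrintCf2.wAllCornerFTwoRamifiedTYZRhoSix_of_facts`: TYZ Thm 1.2 as printed + GZK): CM, `ord_{s=1} L(E,s) = 1`,
`2 ∣ d_K`, `W ∈ CongruentTYZRhoSixFamily` ⇒ `BSD(E,2)`. [folklore] -/
@[conjecture] def WAllCornerFTwoRamifiedTYZRhoSix : Prop :=
  ∀ (W : WeierstrassCurve ℚ) [W.IsElliptic] [W.IsGloballyMinimal],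
    W.HasCM → W.analyticRank = 1 → CMRamified W 2 → CongruentTYZRhoSixFamily W → BSDp W 2

/-- **Flag-free residual OFF the proved TYZ families, OFF `𝒮⁻` AND OFF the ρ-six class (OPEN)** — the residual of
the FLAG-FREE p1 road after both carve-outs. Still contains the U⁺-road leaf where `ρ = 1` or the genus data are
needed (LITERAL), the FJ-atlas leaf (closed), every quartic twist `y² = x³ + Ax` with `−A ∉ ℤ²`, every other `E_m`,
every `j = 287496` / `j = 8000` curve of analytic rank one. No theorem in print. [folklore] -/
@[conjecture] def WAllCornerFTwoRamifiedOffTYZProvedOffSMinusOffRhoSix : Prop :=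
  ∀ (W : WeierstrassCurve ℚ) [W.IsElliptic] [W.IsGloballyMinimal],
    W.HasCM → W.analyticRank = 1 → CMRamified W 2 → ¬ CongruentTYZProvedFamily W →
      ¬ CongruentMonskySMinusFamily W → ¬ CongruentTYZRhoSixFamily W → BSDp W 2

/-- **Six-way residual: OFF the three TYZ family predicates, OFF `𝒮⁻` AND OFF the ρ-six class (OPEN).** No theorem in
print. [folklore] -/
@[conjecture] def WAllCornerFTwoRamifiedOffTYZOffSMinusOffRhoSix : Prop :=
  ∀ (W : WeierstrassCurve ℚ) [W.IsElliptic] [W.IsGloballyMinimal],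
    W.HasCM → W.analyticRank = 1 → CMRamified W 2 →
      ¬ CongruentTYZProvedFamily W → ¬ CongruentTYZUPlusFamily W → ¬ CongruentTYZAtlasFJFamily W →
      ¬ CongruentMonskySMinusFamily W → ¬ CongruentTYZRhoSixFamily W → BSDp W 2

/-! ### §3. Membership facts: the ρ-six class lies in the ramified slice and is disjoint from the proved TYZ families -/

/-- Every member of `CongruentTYZRhoSixFamily` has CM by `ℤ[i]` with `2` ramified (`j = 1728`). [folklore] -/
theorem hasCM_and_cmRamified_two_of_congruentTYZRhoSixFamily {W : WeierstrassCurve ℚ} [W.IsElliptic]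
    [W.IsGloballyMinimal] (h : CongruentTYZRhoSixFamily W) : W.HasCM ∧ CMRamified W 2 := by
  obtain ⟨n, hsq, -, -, -, -, C, hC⟩ := h
  exact hasCM_and_cmRamified_two_of_smul_congruentNumberCurve hsq.ne_zero hC

/-- **The ρ-six class is disjoint from the proved TYZ families**: its parameter `n ≡ 6 (mod 8)` is even, theirs is
odd, and the square-free parameter of a model is unique. [folklore] -/
theorem not_congruentTYZProvedFamily_of_congruentTYZRhoSixFamily {W : WeierstrassCurve ℚ} [W.IsElliptic]
    [W.IsGloballyMinimal] (h : CongruentTYZRhoSixFamily W) : ¬ CongruentTYZProvedFamily W := by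
  intro hP
  obtain ⟨n, hsq, h8, -, -, -, C, hC⟩ := h
  obtain ⟨m, hm, hm2, C', hC'⟩ := exists_smul_congruentNumberCurve_odd_of_congruentTYZProvedFamily hP
  have h := P2.CornerFTwo.Atlas.eq_of_smul_congruentNumberCurve hsq hm hC hC'
  omega

/-! ### §4. Glue (excluded middle on membership; exactness by §3 and by the `𝒮⁻` disjointness of p544597) -/

/-- **Crux 20509's conclusion ⟺ the `𝒮⁻` leaf ∧ the ρ-six leaf ∧ the flag-free residual off both** (EXACT).
[folklore] -/
theorem wAllCornerFTwoRamifiedOffTYZProved_iff_sMinus_rhoSix_off :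
    WAllCornerFTwoRamifiedOffTYZProved ↔
      WAllCornerFTwoRamifiedSMinus ∧ WAllCornerFTwoRamifiedTYZRhoSix ∧
        WAllCornerFTwoRamifiedOffTYZProvedOffSMinusOffRhoSix := by
  constructor
  · intro h
    exact ⟨wAllCornerFTwoRamifiedSMinus_of_offTYZProved h,
      fun W _ _ hcm hr1 hram hR ↦
        h W hcm hr1 hram (not_congruentTYZProvedFamily_of_congruentTYZRhoSixFamily hR),
      fun W _ _ hcm hr1 hram hn _ _ ↦ h W hcm hr1 hram hn⟩
  · rintro ⟨hS, hR, hO⟩ W _ _ hcm hr1 hram hn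
    by_cases h1 : CongruentMonskySMinusFamily W
    · exact hS W hcm hr1 hram h1
    · by_cases h2 : CongruentTYZRhoSixFamily W
      · exact hR W hcm hr1 hram h2
      · exact hO W hcm hr1 hram hn h1 h2

/-- The flag-free residual off `𝒮⁻` ⟹ (its restriction) the ρ-six leaf's members off `𝒮⁻` … stated as: the
residual off `𝒮⁻` splits into the ρ-six part and the residual off both (EXACT; the ρ-six part spelled out with its
non-membership binders). [folklore] -/
theorem wAllCornerFTwoRamifiedOffTYZProvedOffSMinus_iff_onRhoSix_off :
    WAllCornerFTwoRamifiedOffTYZProvedOffSMinus ↔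
      (∀ (W : WeierstrassCurve ℚ) [W.IsElliptic] [W.IsGloballyMinimal],
          W.HasCM → W.analyticRank = 1 → CMRamified W 2 → ¬ CongruentTYZProvedFamily W →
            ¬ CongruentMonskySMinusFamily W → CongruentTYZRhoSixFamily W → BSDp W 2) ∧
      WAllCornerFTwoRamifiedOffTYZProvedOffSMinusOffRhoSix := by
  constructor
  · intro h
    exact ⟨fun W _ _ hcm hr1 hram hn hs _ ↦ h W hcm hr1 hram hn hs,
      fun W _ _ hcm hr1 hram hn hs _ ↦ h W hcm hr1 hram hn hs⟩
  · rintro ⟨hR, hO⟩ W _ _ hcm hr1 hram hn hs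
    by_cases h2 : CongruentTYZRhoSixFamily W
    · exact hR W hcm hr1 hram hn hs h2
    · exact hO W hcm hr1 hram hn hs h2

/-- The flag-free residual off `𝒮⁻` from the ρ-six leaf and the residual off both. [folklore] -/
theorem wAllCornerFTwoRamifiedOffTYZProvedOffSMinus_of_rhoSix_of_off (hR : WAllCornerFTwoRamifiedTYZRhoSix)
    (hO : WAllCornerFTwoRamifiedOffTYZProvedOffSMinusOffRhoSix) : WAllCornerFTwoRamifiedOffTYZProvedOffSMinus :=
  wAllCornerFTwoRamifiedOffTYZProvedOffSMinus_iff_onRhoSix_off.2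
    ⟨fun W _ _ hcm hr1 hram _ _ h2 ↦ hR W hcm hr1 hram h2, hO⟩

/-- **The five-way residual ⟺ its ρ-six part ∧ the six-way residual** (EXACT; pure logic). [folklore] -/
theorem wAllCornerFTwoRamifiedOffTYZOffSMinus_iff_onRhoSix_off :
    WAllCornerFTwoRamifiedOffTYZOffSMinus ↔
      (∀ (W : WeierstrassCurve ℚ) [W.IsElliptic] [W.IsGloballyMinimal],
          W.HasCM → W.analyticRank = 1 → CMRamified W 2 → ¬ CongruentTYZProvedFamily W →
            ¬ CongruentTYZUPlusFamily W → ¬ CongruentTYZAtlasFJFamily W → ¬ CongruentMonskySMinusFamily W →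
            CongruentTYZRhoSixFamily W → BSDp W 2) ∧
      WAllCornerFTwoRamifiedOffTYZOffSMinusOffRhoSix := by
  constructor
  · intro h
    exact ⟨fun W _ _ hcm hr1 hram h1 h2 h3 h4 _ ↦ h W hcm hr1 hram h1 h2 h3 h4,
      fun W _ _ hcm hr1 hram h1 h2 h3 h4 _ ↦ h W hcm hr1 hram h1 h2 h3 h4⟩
  · rintro ⟨hR, hO⟩ W _ _ hcm hr1 hram h1 h2 h3 h4
    by_cases h5 : CongruentTYZRhoSixFamily W
    · exact hR W hcm hr1 hram h1 h2 h3 h4 h5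
    · exact hO W hcm hr1 hram h1 h2 h3 h4 h5

/-- **The five-way residual from the ρ-six leaf and the six-way residual** — the registered residual stub of crux
20509 (`𝔅_ram ⟹` five-way residual) REDUCES to the six-way residual once the ρ-six class is closed. [folklore] -/
theorem wAllCornerFTwoRamifiedOffTYZOffSMinus_of_rhoSix_of_off (hR : WAllCornerFTwoRamifiedTYZRhoSix)
    (hO : WAllCornerFTwoRamifiedOffTYZOffSMinusOffRhoSix) : WAllCornerFTwoRamifiedOffTYZOffSMinus :=
  wAllCornerFTwoRamifiedOffTYZOffSMinus_iff_onRhoSix_off.2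
    ⟨fun W _ _ hcm hr1 hram _ _ _ _ h5 ↦ hR W hcm hr1 hram h5, hO⟩

/-- The six-way residual is a restriction of the five-way one. [folklore] -/
theorem wAllCornerFTwoRamifiedOffTYZOffSMinusOffRhoSix_of_offSMinus (h : WAllCornerFTwoRamifiedOffTYZOffSMinus) :
    WAllCornerFTwoRamifiedOffTYZOffSMinusOffRhoSix :=
  (wAllCornerFTwoRamifiedOffTYZOffSMinus_iff_onRhoSix_off.1 h).2

/-- **The reshaped composition of crux `RamifiedOffTYZOfFacts`' skeleton (five leaves)**: U⁺-road leaf, FJ-atlas leaf,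
`𝒮⁻` leaf, ρ-six leaf and the six-way residual together give the crux's conclusion `WAllCornerFTwoRamifiedOffTYZProved`
(excluded middle only). [folklore] -/
theorem wAllCornerFTwoRamifiedOffTYZProved_of_uPlus_of_atlasFJ_of_sMinus_of_rhoSix_of_off
    (hU : WAllCornerFTwoRamifiedTYZUPlus) (hF : WAllCornerFTwoRamifiedTYZAtlasFJ)
    (hS : WAllCornerFTwoRamifiedSMinus) (hR : WAllCornerFTwoRamifiedTYZRhoSix)
    (hO : WAllCornerFTwoRamifiedOffTYZOffSMinusOffRhoSix) : WAllCornerFTwoRamifiedOffTYZProved :=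
  wAllCornerFTwoRamifiedOffTYZProved_of_uPlus_of_atlasFJ_of_sMinus_of_offSMinus hU hF hS
    (wAllCornerFTwoRamifiedOffTYZOffSMinus_of_rhoSix_of_off hR hO)

/-- The ρ-six leaf is a restriction of crux 20509's conclusion (by the disjointness of §3) … [folklore] -/
theorem wAllCornerFTwoRamifiedTYZRhoSix_of_offTYZProved (h : WAllCornerFTwoRamifiedOffTYZProved) :
    WAllCornerFTwoRamifiedTYZRhoSix :=
  (wAllCornerFTwoRamifiedOffTYZProved_iff_sMinus_rhoSix_off.1 h).2.1

/-- … and the residual off both is the last restriction. [folklore] -/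
theorem wAllCornerFTwoRamifiedOffTYZProvedOffSMinusOffRhoSix_of_offTYZProved
    (h : WAllCornerFTwoRamifiedOffTYZProved) : WAllCornerFTwoRamifiedOffTYZProvedOffSMinusOffRhoSix :=
  (wAllCornerFTwoRamifiedOffTYZProved_iff_sMinus_rhoSix_off.1 h).2.2

/-- The ρ-six leaf is a restriction of the ramified slice … [folklore] -/
theorem wAllCornerFTwoRamifiedTYZRhoSix_of_wAllCornerFTwoRamified (h : WAllCornerFTwoRamified) :
    WAllCornerFTwoRamifiedTYZRhoSix :=
  fun W _ _ hcm hr1 hram _ ↦ h W hcm hr1 hram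

/-- … of row 12₂ … [folklore] -/
theorem wAllCornerFTwoRamifiedTYZRhoSix_of_wAllCornerFTwo (h : WAllCornerFTwo) : WAllCornerFTwoRamifiedTYZRhoSix :=
  wAllCornerFTwoRamifiedTYZRhoSix_of_wAllCornerFTwoRamified (wAllCornerFTwo_iff_slices.1 h).2.2.1

/-- … and of `WAll`. [folklore] -/
theorem wAllCornerFTwoRamifiedTYZRhoSix_of_wAll (h : WAll) : WAllCornerFTwoRamifiedTYZRhoSix :=
  wAllCornerFTwoRamifiedTYZRhoSix_of_wAllCornerFTwoRamified (cmTwoSlices_of_wAll h).2.2.1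

/-- The six-way residual follows from the ramified slice. [folklore] -/
theorem wAllCornerFTwoRamifiedOffTYZOffSMinusOffRhoSix_of_wAllCornerFTwoRamified (h : WAllCornerFTwoRamified) :
    WAllCornerFTwoRamifiedOffTYZOffSMinusOffRhoSix :=
  fun W _ _ hcm hr1 hram _ _ _ _ _ ↦ h W hcm hr1 hram

/-- The flag-free residual off both carve-outs follows from the ramified slice. [folklore] -/
theorem wAllCornerFTwoRamifiedOffTYZProvedOffSMinusOffRhoSix_of_wAllCornerFTwoRamified
    (h : WAllCornerFTwoRamified) : WAllCornerFTwoRamifiedOffTYZProvedOffSMinusOffRhoSix :=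
  fun W _ _ hcm hr1 hram _ _ _ ↦ h W hcm hr1 hram

/-- **The ramified slice ⟺ ON the proved TYZ families ∧ ON `𝒮⁻` ∧ ON the ρ-six class ∧ OFF all three** (EXACT) — the
four-way flag-free cut the route `PrintCf2` can glue inside `𝔅_ram`. [folklore] -/
theorem wAllCornerFTwoRamified_iff_tyzProved_sMinus_rhoSix_off :
    WAllCornerFTwoRamified ↔ WAllCornerFTwoRamifiedTYZProved ∧ WAllCornerFTwoRamifiedSMinus ∧
      WAllCornerFTwoRamifiedTYZRhoSix ∧ WAllCornerFTwoRamifiedOffTYZProvedOffSMinusOffRhoSix := by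
  rw [wAllCornerFTwoRamified_iff_tyzProved_offTYZProved, wAllCornerFTwoRamifiedOffTYZProved_iff_sMinus_rhoSix_off]

/-- **Row 12₂ with the proved TYZ families, `𝒮⁻` and the ρ-six class carved out (flag-free cut)**:
`WAllCornerFTwo` ⟺ split-good ∧ split-bad ∧ (TYZProved ∧ SMinus ∧ TYZRhoSix ∧ residual) ∧ inert-good ∧ inert-bad.
[folklore] -/
theorem wAllCornerFTwo_iff_slices_tyzProved_sMinus_rhoSix :
    WAllCornerFTwo ↔ WAllCornerFTwoSplitGood ∧ WAllCornerFTwoSplitBad ∧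
      (WAllCornerFTwoRamifiedTYZProved ∧ WAllCornerFTwoRamifiedSMinus ∧ WAllCornerFTwoRamifiedTYZRhoSix ∧
        WAllCornerFTwoRamifiedOffTYZProvedOffSMinusOffRhoSix) ∧
      WAllCornerFTwoInertGood ∧ WAllCornerFTwoInertBad := by
  rw [wAllCornerFTwo_iff_slices_tyzProved, wAllCornerFTwoRamifiedOffTYZProved_iff_sMinus_rhoSix_off]

end Summit.BirchSwinnertonDyer

end
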